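import Summits.RiemannHypothesis.RiemannHypothesis.Theorems.LiPrimeEchoEdgeTerms
import HarnessLib

/-!
# RiemannHypothesis / LiPrimeEcho — crux K2 `LiPrimeEdgeEcho`, part 2: the non-resonant prime-power terms (RH-FREE)

RH-FREE [rh-li-prover].  Route `Theses/LiPrimeEcho.lean` (rung «Li PRIME-ECHO LAW» `LiTheory.LiZeroWindowEcho`), item
`LiPrimeEdgeEcho` (stmt-RiemannHypothesis-19245).  The term `Λ(m) m^{−w} z^{±n}` of `L(Λ, w) k_n(w)` (`w = 3/2 + iy`,
`z = (w − 1)/w`, part 1) has logarithmic derivative `θ = −i log m ± n ζ` with `|Im θ| ≥ log m` (resp. `≥ log m − 1 > 1/11`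
for `m ≥ 3`, `y ≥ √n`), and `|θ'| ≤ 3n/y³`; one integration by parts (`norm_integral_le_of_logDeriv`:
`‖∫ E‖ ≤ 2M/D + (β − α) M B/D²` when `E' = Eθ`, `|θ| ≥ D`, `|E| ≤ M`, `|θ'| ≤ B` — van der Corput's first-derivative
test [Titchmarsh 1986, Lemma 4.3] in logarithmic-derivative form) bounds every NON-RESONANT term by `O_c(m^{−3/2})` on
windows `[T₁, T₂] ⊂ [√n, c√n + 1]`, uniformly in `n`.  The resonant term is `m = 2` against `z⁻ⁿ` (`PrimeEdge.edgeTwo`).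
Nothing here bears on the truth of RH.
-/

noncomputable section

-- D-0017: `Summit.<S>.<S>.…` is the designed namespace of a single-problem summit.
set_option linter.dupNamespace false

open Complex MeasureTheory intervalIntegral Set
open scoped Real Interval ArithmeticFunction.vonMangoldt

namespace Summit.RiemannHypothesis.RiemannHypothesis.Theorems.LiTheory

namespace PrimeEdge

/-! ### One integration by parts against a logarithmic derivative -/

/-- **First-derivative test, complex form.**  If `E' = Eθ` on `[a, b]` with `θ` differentiable, `θ'` continuous,
`|θ| ≥ D > 0`, `|E| ≤ M`, `|θ'| ≤ B`, then `‖∫_a^b E‖ ≤ 2M/D + (b − a) M B/D²`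
(`∫ E = [E/θ] + ∫ E θ'/θ²`). [Titchmarsh 1986, Lemma 4.3, in logarithmic-derivative form] -/
theorem norm_integral_le_of_logDeriv {E θ θ' : ℝ → ℂ} {a b D M B : ℝ} (hab : a ≤ b) (hD : 0 < D)
    (hM : 0 ≤ M) (hB : 0 ≤ B)
    (hE : ∀ y ∈ Icc a b, HasDerivAt E (E y * θ y) y) (hθ : ∀ y ∈ Icc a b, HasDerivAt θ (θ' y) y)
    (hθ'c : ContinuousOn θ' (Icc a b))
    (hDb : ∀ y ∈ Icc a b, D ≤ ‖θ y‖) (hMb : ∀ y ∈ Icc a b, ‖E y‖ ≤ M) (hBb : ∀ y ∈ Icc a b, ‖θ' y‖ ≤ B) :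
    ‖∫ y in a..b, E y‖ ≤ 2 * M / D + (b - a) * (M * B / D ^ 2) := by
  have hθ0 : ∀ y ∈ Icc a b, θ y ≠ 0 := fun y hy h ↦ by
    have := hDb y hy; rw [h, norm_zero] at this; linarith
  have hEc : ContinuousOn E (Icc a b) := fun y hy ↦ (hE y hy).continuousAt.continuousWithinAt
  have hθc : ContinuousOn θ (Icc a b) := fun y hy ↦ (hθ y hy).continuousAt.continuousWithinAt
  -- `F = E/θ`, `F' = E − Eθ'/θ²`
  have hF : ∀ y ∈ Icc a b, HasDerivAt (fun y ↦ E y / θ y) (E y - E y * θ' y / θ y ^ 2) y := by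
    intro y hy
    refine ((hE y hy).div (hθ y hy) (hθ0 y hy)).congr_deriv ?_
    have := hθ0 y hy
    field_simp
  have hGc : ContinuousOn (fun y ↦ E y * θ' y / θ y ^ 2) (Icc a b) :=
    (hEc.mul hθ'c).div (hθc.pow 2) fun y hy ↦ pow_ne_zero _ (hθ0 y hy)
  have hIcc : uIcc a b = Icc a b := uIcc_of_le hab
  have hiG : IntervalIntegrable (fun y ↦ E y * θ' y / θ y ^ 2) volume a b :=
    (hGc.mono hIcc.le).intervalIntegrable
  have hiF' : IntervalIntegrable (fun y ↦ E y - E y * θ' y / θ y ^ 2) volume a b :=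
    ((hEc.mono hIcc.le).intervalIntegrable).sub hiG
  have hFTC : ∫ y in a..b, (E y - E y * θ' y / θ y ^ 2) = E b / θ b - E a / θ a :=
    integral_eq_sub_of_hasDerivAt (fun y hy ↦ hF y (hIcc ▸ hy)) hiF'
  have hsplit : (∫ y in a..b, E y) = (E b / θ b - E a / θ a) + ∫ y in a..b, E y * θ' y / θ y ^ 2 := by
    rw [← hFTC, ← intervalIntegral.integral_add hiF' hiG]
    refine intervalIntegral.integral_congr fun y _ ↦ ?_
    simp only [sub_add_cancel]
  -- the boundary terms
  have hbd : ∀ y ∈ Icc a b, ‖E y / θ y‖ ≤ M / D := fun y hy ↦ by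
    rw [norm_div]
    exact div_le_div₀ hM (hMb y hy) hD (hDb y hy)
  -- the integral term
  have hint : ‖∫ y in a..b, E y * θ' y / θ y ^ 2‖ ≤ M * B / D ^ 2 * |b - a| := by
    refine intervalIntegral.norm_integral_le_of_norm_le_const fun y hy ↦ ?_
    rw [uIoc_of_le hab] at hy
    have hy' : y ∈ Icc a b := ⟨hy.1.le, hy.2⟩
    rw [norm_div, norm_mul, norm_pow]
    have hθD : D ^ 2 ≤ ‖θ y‖ ^ 2 := pow_le_pow_left₀ hD.le (hDb y hy') 2
    have num : ‖E y‖ * ‖θ' y‖ ≤ M * B := mul_le_mul (hMb y hy') (hBb y hy') (norm_nonneg _) hM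
    exact div_le_div₀ (mul_nonneg hM hB) num (pow_pos hD 2) hθD
  rw [abs_of_nonneg (sub_nonneg.2 hab)] at hint
  calc ‖∫ y in a..b, E y‖ = ‖(E b / θ b - E a / θ a) + ∫ y in a..b, E y * θ' y / θ y ^ 2‖ := by rw [hsplit]
    _ ≤ ‖E b / θ b‖ + ‖E a / θ a‖ + ‖∫ y in a..b, E y * θ' y / θ y ^ 2‖ :=
        (norm_add_le _ _).trans (add_le_add (norm_sub_le _ _) le_rfl)
    _ ≤ M / D + M / D + M * B / D ^ 2 * (b - a) :=
        add_le_add (add_le_add (hbd b (right_mem_Icc.2 hab)) (hbd a (left_mem_Icc.2 hab))) hint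
    _ = 2 * M / D + (b - a) * (M * B / D ^ 2) := by ring

/-! ### The non-resonant terms -/

/-- `log 3 − 1 > 1/11`. -/
theorem log_three_sub_one_gt : (1 / 11 : ℝ) < Real.log 3 - 1 := by
  have h3 : Real.log 3 - 1 = Real.log (3 / Real.exp 1) := by
    rw [Real.log_div (by norm_num) (Real.exp_pos 1).ne', Real.log_exp]
  rw [h3]
  have hx : 0 < 3 / Real.exp 1 := by positivity
  refine lt_of_lt_of_le ?_ (Real.one_sub_inv_le_log_of_pos hx)
  rw [inv_div]
  have := Real.exp_one_lt_d9
  have : Real.exp 1 / 3 < 2.7182818286 / 3 := by gcongr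
  linarith

/-- Window facts: on `[T₁, T₂] ⊂ [√n, c√n + 1]` with `n ≥ 1`: `1 ≤ T₁`, `n ≤ T₁²`, `n^{3/2} ≤ T₁³`-type bounds. -/
theorem window_facts {n : ℕ} {T₁ : ℝ} (hn : 1 ≤ n) (h1 : Real.sqrt n ≤ T₁) :
    1 ≤ T₁ ∧ (n : ℝ) ≤ T₁ ^ 2 ∧ (n : ℝ) * Real.sqrt n ≤ T₁ ^ 3 := by
  have hn' : (1 : ℝ) ≤ n := by exact_mod_cast hn
  have hs1 : 1 ≤ Real.sqrt n := by rw [← Real.sqrt_one]; exact Real.sqrt_le_sqrt hn'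
  have hs0 : 0 ≤ Real.sqrt n := Real.sqrt_nonneg _
  have hsq : Real.sqrt n ^ 2 = n := Real.sq_sqrt (by positivity)
  refine ⟨hs1.trans h1, ?_, ?_⟩
  · nlinarith
  · calc (n : ℝ) * Real.sqrt n = Real.sqrt n ^ 3 := by rw [pow_succ, hsq]
      _ ≤ T₁ ^ 3 := pow_le_pow_left₀ hs0 h1 3

/-- **The `F_n(w)` terms are non-resonant**: for `m ≥ 2`, `n ≥ 1`, `√n ≤ T₁ ≤ T₂ ≤ c√n + 1` (`c ≥ 1`),
`‖∫_{T₁}^{T₂} m^{−w} zⁿ dy‖ ≤ m^{−3/2} (4 + 12(c + 1))` (phase derivative `≤ −log m`). -/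
theorem norm_integral_plus_le {c : ℝ} (hc : 1 ≤ c) {n m : ℕ} (hn : 1 ≤ n) (hm : 2 ≤ m) {T₁ T₂ : ℝ}
    (h1 : Real.sqrt n ≤ T₁) (h12 : T₁ ≤ T₂) (h2 : T₂ ≤ c * Real.sqrt n + 1) :
    ‖∫ y in T₁..T₂, (m : ℂ) ^ (-liRightPt y) * zq y ^ n‖ ≤ (m : ℝ) ^ (-(3 / 2 : ℝ)) * (4 + 12 * (c + 1)) := by
  obtain ⟨hT1, hT2, hT3⟩ := window_facts hn h1
  have hm0 : 0 < m := by omega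
  have hlogm : Real.log 2 ≤ Real.log m := Real.log_le_log (by norm_num) (by exact_mod_cast hm)
  have hl2 : (1 / 2 : ℝ) ≤ Real.log 2 := by linarith [Real.log_two_gt_d9]
  have hD : 0 < Real.log m := by linarith
  set M : ℝ := (m : ℝ) ^ (-(3 / 2 : ℝ)) with hM
  have hM0 : 0 ≤ M := by positivity
  set B : ℝ := 3 * n / T₁ ^ 3 with hB
  have hB0 : 0 ≤ B := by positivity
  have hs0 : 0 ≤ Real.sqrt n := Real.sqrt_nonneg _
  have key := norm_integral_le_of_logDeriv (E := fun y ↦ (m : ℂ) ^ (-liRightPt y) * zq y ^ n)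
    (θ := fun y ↦ -(Real.log m * I) + n * ld y) (θ' := fun y ↦ n * ld' y) (D := Real.log m) (M := M) (B := B)
    h12 hD hM0 hB0
    (fun y _ ↦ by
      have := (hasDerivAt_cpow_neg_rightPt hm0 y).mul (hasDerivAt_zq_pow n y)
      refine this.congr_deriv ?_
      ring)
    (fun y _ ↦ ((hasDerivAt_ld y).const_mul (n : ℂ)).const_add _)
    ((continuous_const.mul continuous_ld').continuousOn)
    (fun y hy ↦ by
      have hy1 : 1 ≤ y := hT1.trans hy.1
      refine le_trans ?_ (Complex.abs_im_le_norm _)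
      have him : ((-(Real.log m * I) + n * ld y : ℂ)).im = -Real.log m + n * (ld y).im := by
        simp only [Complex.add_im, Complex.neg_im, Complex.mul_im, Complex.ofReal_re, Complex.ofReal_im,
          Complex.I_re, Complex.I_im, Complex.natCast_re, Complex.natCast_im, mul_zero, mul_one, zero_mul,
          add_zero]
      rw [him]
      have := (ld_im_bounds hy1).1
      have : (n : ℝ) * (ld y).im ≤ 0 := mul_nonpos_of_nonneg_of_nonpos (Nat.cast_nonneg n) this
      rw [abs_of_nonpos (by linarith)]
      linarith)
    (fun y _ ↦ by
      rw [norm_mul, norm_cpow_neg_rightPt hm0]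
      exact mul_le_of_le_one_right hM0 (norm_zq_pow_le_one n y))
    (fun y hy ↦ by
      have hy1 : 1 ≤ y := hT1.trans hy.1
      have hy0 : 0 < y := by linarith
      rw [norm_mul, Complex.norm_natCast]
      calc (n : ℝ) * ‖ld' y‖ ≤ n * (3 / y ^ 3) := by gcongr; exact norm_ld'_le hy1
        _ ≤ n * (3 / T₁ ^ 3) := by gcongr; exact hy.1
        _ = B := by rw [hB]; ring)
  refine key.trans ?_
  -- `2M/log m + (T₂ − T₁) M B/log² m ≤ M (4 + 12(c+1))`
  have hlen : T₂ - T₁ ≤ c * Real.sqrt n + 1 := by linarith [hs0.trans h1]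
  have hlenB : (T₂ - T₁) * B ≤ 3 * (c + 1) := by
    have hT10 : 0 < T₁ ^ 3 := by positivity
    have e1 : (c * Real.sqrt n + 1) * (3 * n) ≤ 3 * (c + 1) * T₁ ^ 3 := by
      have : (c * Real.sqrt n + 1) * n ≤ (c + 1) * (n * Real.sqrt n) := by
        have hn1 : (1 : ℝ) ≤ n := by exact_mod_cast hn
        have hs1 : 1 ≤ Real.sqrt n := by rw [← Real.sqrt_one]; exact Real.sqrt_le_sqrt hn1
        nlinarith [mul_nonneg (by linarith : (0:ℝ) ≤ c) hs0]
      nlinarith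
    calc (T₂ - T₁) * B ≤ (c * Real.sqrt n + 1) * B := by gcongr
      _ = (c * Real.sqrt n + 1) * (3 * n) / T₁ ^ 3 := by rw [hB]; ring
      _ ≤ 3 * (c + 1) * T₁ ^ 3 / T₁ ^ 3 := by gcongr
      _ = 3 * (c + 1) := by field_simp
  have h1D : 1 / Real.log m ≤ 2 := by rw [div_le_iff₀ hD]; linarith
  have h1D2 : 1 / Real.log m ^ 2 ≤ 4 := by
    rw [div_le_iff₀ (by positivity)]; nlinarith
  calc 2 * M / Real.log m + (T₂ - T₁) * (M * B / Real.log m ^ 2)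
      = 2 * M * (1 / Real.log m) + ((T₂ - T₁) * B) * M * (1 / Real.log m ^ 2) := by ring
    _ ≤ 2 * M * 2 + 3 * (c + 1) * M * 4 := by
        gcongr
    _ = M * (4 + 12 * (c + 1)) := by ring

/-- **The `F_n(1 − w)` terms with `m ≥ 3` are non-resonant**: for `m ≥ 3`, `n ≥ 1`, `√n ≤ T₁ ≤ T₂ ≤ c√n + 1`,
`‖∫_{T₁}^{T₂} m^{−w} z⁻ⁿ dy‖ ≤ m^{−3/2} · e (22 + 363(c + 1))` (phase derivative `≥ log m − 1 > 1/11`). -/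
theorem norm_integral_minus_le {c : ℝ} (hc : 1 ≤ c) {n m : ℕ} (hn : 1 ≤ n) (hm : 3 ≤ m) {T₁ T₂ : ℝ}
    (h1 : Real.sqrt n ≤ T₁) (h12 : T₁ ≤ T₂) (h2 : T₂ ≤ c * Real.sqrt n + 1) :
    ‖∫ y in T₁..T₂, (m : ℂ) ^ (-liRightPt y) * (zq y ^ n)⁻¹‖ ≤
      (m : ℝ) ^ (-(3 / 2 : ℝ)) * (Real.exp 1 * (22 + 363 * (c + 1))) := by
  obtain ⟨hT1, hT2, hT3⟩ := window_facts hn h1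
  have hm0 : 0 < m := by omega
  have hlogm : Real.log 3 ≤ Real.log m := Real.log_le_log (by norm_num) (by exact_mod_cast hm)
  have hl3 := log_three_sub_one_gt
  set D : ℝ := Real.log m - 1 with hDdef
  have hD : 1 / 11 < D := by rw [hDdef]; linarith
  have hD0 : 0 < D := by linarith
  set M : ℝ := (m : ℝ) ^ (-(3 / 2 : ℝ)) * Real.exp 1 with hM
  have hM0 : 0 ≤ M := by positivity
  set B : ℝ := 3 * n / T₁ ^ 3 with hB
  have hB0 : 0 ≤ B := by positivity
  have hs0 : 0 ≤ Real.sqrt n := Real.sqrt_nonneg _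
  have key := norm_integral_le_of_logDeriv (E := fun y ↦ (m : ℂ) ^ (-liRightPt y) * (zq y ^ n)⁻¹)
    (θ := fun y ↦ -(Real.log m * I) + -(n * ld y)) (θ' := fun y ↦ -(n * ld' y)) (D := D) (M := M) (B := B)
    h12 hD0 hM0 hB0
    (fun y _ ↦ by
      have := (hasDerivAt_cpow_neg_rightPt hm0 y).mul (hasDerivAt_zq_pow_inv n y)
      refine this.congr_deriv ?_
      ring)
    (fun y _ ↦ ((hasDerivAt_ld y).const_mul (n : ℂ)).neg.const_add _)
    ((continuous_const.mul continuous_ld').neg.continuousOn)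
    (fun y hy ↦ by
      have hy1 : 1 ≤ y := hT1.trans hy.1
      have hy0 : 0 < y := by linarith
      refine le_trans ?_ (Complex.abs_im_le_norm _)
      have him : ((-(Real.log m * I) + -(n * ld y) : ℂ)).im = -Real.log m + n * (-(ld y).im) := by
        simp only [Complex.add_im, Complex.neg_im, Complex.mul_im, Complex.ofReal_re, Complex.ofReal_im,
          Complex.I_re, Complex.I_im, Complex.natCast_re, Complex.natCast_im, mul_zero, mul_one, zero_mul,
          add_zero, mul_neg]
      rw [him]
      obtain ⟨hi1, hi2⟩ := ld_im_bounds hy1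
      have hny : (n : ℝ) * (1 / y ^ 2) ≤ 1 := by
        rw [mul_one_div, div_le_one (by positivity)]
        exact hT2.trans (pow_le_pow_left₀ (by linarith) hy.1 2)
      have : (n : ℝ) * (-(ld y).im) ≤ 1 := (mul_le_mul_of_nonneg_left hi2 (Nat.cast_nonneg n)).trans hny
      rw [abs_of_nonpos (by linarith)]
      linarith)
    (fun y hy ↦ by
      rw [norm_mul, norm_cpow_neg_rightPt hm0, hM]
      exact mul_le_mul_of_nonneg_left (norm_zq_pow_inv_le n (h1.trans hy.1)) (by positivity))
    (fun y hy ↦ by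
      have hy1 : 1 ≤ y := hT1.trans hy.1
      have hy0 : 0 < y := by linarith
      rw [norm_neg, norm_mul, Complex.norm_natCast]
      calc (n : ℝ) * ‖ld' y‖ ≤ n * (3 / y ^ 3) := by gcongr; exact norm_ld'_le hy1
        _ ≤ n * (3 / T₁ ^ 3) := by gcongr; exact hy.1
        _ = B := by rw [hB]; ring)
  refine key.trans ?_
  have hlen : T₂ - T₁ ≤ c * Real.sqrt n + 1 := by linarith [hs0.trans h1]
  have hlenB : (T₂ - T₁) * B ≤ 3 * (c + 1) := by
    have hT10 : 0 < T₁ ^ 3 := by positivity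
    have e1 : (c * Real.sqrt n + 1) * (3 * n) ≤ 3 * (c + 1) * T₁ ^ 3 := by
      have : (c * Real.sqrt n + 1) * n ≤ (c + 1) * (n * Real.sqrt n) := by
        have hn1 : (1 : ℝ) ≤ n := by exact_mod_cast hn
        have hs1 : 1 ≤ Real.sqrt n := by rw [← Real.sqrt_one]; exact Real.sqrt_le_sqrt hn1
        nlinarith [mul_nonneg (by linarith : (0:ℝ) ≤ c) hs0]
      nlinarith
    calc (T₂ - T₁) * B ≤ (c * Real.sqrt n + 1) * B := by gcongr
      _ = (c * Real.sqrt n + 1) * (3 * n) / T₁ ^ 3 := by rw [hB]; ring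
      _ ≤ 3 * (c + 1) * T₁ ^ 3 / T₁ ^ 3 := by gcongr
      _ = 3 * (c + 1) := by field_simp
  have h1D : 1 / D ≤ 11 := by
    rw [div_le_iff₀ hD0]; nlinarith
  have h1D2 : 1 / D ^ 2 ≤ 121 := by
    rw [div_le_iff₀ (by positivity)]; nlinarith
  calc 2 * M / D + (T₂ - T₁) * (M * B / D ^ 2)
      = 2 * M * (1 / D) + ((T₂ - T₁) * B) * M * (1 / D ^ 2) := by ring
    _ ≤ 2 * M * 11 + 3 * (c + 1) * M * 121 := by gcongr
    _ = (m : ℝ) ^ (-(3 / 2 : ℝ)) * (Real.exp 1 * (22 + 363 * (c + 1))) := by rw [hM]; ring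

/-! ### The resonant piece -/

/-- The RESONANT piece of the prime edge: the `m = 2` term of `L(Λ, w)` against the reflected weight `F_n(1 − w) = z⁻ⁿ`,
`(1/π) Re ∫_{T₁}^{T₂} Λ(2) 2^{−w} z⁻ⁿ dy` (phase `−(y log 2 + n arg z)`, stationary at `y ≈ √(n/log 2)`). -/
def edgeTwo (n : ℕ) (T₁ T₂ : ℝ) : ℝ :=
  1 / Real.pi * (∫ y in T₁..T₂, (Λ 2 : ℂ) * (2 : ℂ) ^ (-liRightPt y) * (zq y ^ n)⁻¹).re

end PrimeEdge

end Summit.RiemannHypothesis.RiemannHypothesis.Theorems.LiTheory
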